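import Mathlib
import Literature.Computability.AlgebraicComplexity.StandardFamilies

/-!
# Class weights of the band-pencil products (crux `ValuativeGCT.ValuativeFlip`, stub `stub_fourRowPencilRank`)

The concrete half of the class split PE3(a) (`Cruxes/ValuativeFlip/DECOMPOSITIONS.md`,
`Cruxes/ValuativeFlip/AxisK2G1PencilRankTables.md`) for hypothesis `H` of
`fourRowPencilRank_of_pencilCertificate`: for a CYCLIC BAND pencil `M : Fin n × Fin n → Fin 4 → R`
(entry `(a, b)` may involve `y_t` only if `b ≡ a + t (mod n)`), every product
`X t * aeval (fun ab => Σ_s M ab s • X s) (∂_(i,j) per_n)` appearing in `H` is weighted-homogeneous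
for the weighting `y_s ↦ s ∈ ℤ/n`, of weight `t + (i - j)` (`bpw_bandProduct_isWeightedHomogeneous`).
Hence the `4n²` products fall into `n` classes `q = i - j + t` with pairwise disjoint supports and
per-class rank certificates add up (`prc_linearIndependent_of_weightedClasses`,
`Theorems/ValuativeGCTValuativeFlipPencilRankClassSplit.lean`).

Ingredients, all general: `pderiv v` shifts weights by `-w v` (`bpw_isWeightedHomogeneous_pderiv`);
`aeval` by a substitution whose values are weighted-homogeneous of the weights of the variables
preserves weighted homogeneity (`bpw_isWeightedHomogeneous_aeval`); the generic permanent has weight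
`0` for `(a, b) ↦ b - a` (`bpw_perPoly_isWeightedHomogeneous`, `Σ_l (l - σ l) = 0`).
[folklore; Mathlib `MvPolynomial.IsWeightedHomogeneous`]
-/

set_option linter.dupNamespace false

namespace Summit.ValiantsHypothesis.ValiantsHypothesis.Theorems.ValuativeFlip

open MvPolynomial
open scoped BigOperators
open Literature.Computability.AlgebraicComplexity

/-- **`pderiv` shifts weights.**  If `φ` is weighted-homogeneous of weight `m` for weights in an
additive group, then `∂φ/∂X_v` is weighted-homogeneous of weight `m - w v`. [folklore] -/
theorem bpw_isWeightedHomogeneous_pderiv {R σ A : Type*} [CommRing R] [AddCommGroup A]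
    (w : σ → A) {φ : MvPolynomial σ R} {m : A} (hφ : IsWeightedHomogeneous w φ m) (v : σ) :
    IsWeightedHomogeneous w (pderiv v φ) (m - w v) := by
  intro d hd
  rw [coeff_pderiv] at hd
  have h1 : coeff (d + Finsupp.single v 1) φ ≠ 0 := fun h => hd (by rw [h, zero_mul])
  have h2 := hφ h1
  rw [map_add, Finsupp.weight_single, one_smul] at h2
  rw [← h2, add_sub_cancel_right]

/-- **`aeval` by weighted-homogeneous values preserves weighted homogeneity.**  If every value
`g v` is `w'`-weighted-homogeneous of weight `w v`, then `aeval g` maps `w`-weighted-homogeneous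
polynomials of weight `m` to `w'`-weighted-homogeneous polynomials of weight `m`. [folklore] -/
theorem bpw_isWeightedHomogeneous_aeval {R σ τ A : Type*} [CommRing R] [AddCommMonoid A]
    (w : σ → A) (w' : τ → A) (g : σ → MvPolynomial τ R)
    (hg : ∀ v, IsWeightedHomogeneous w' (g v) (w v)) {φ : MvPolynomial σ R} {m : A}
    (hφ : IsWeightedHomogeneous w φ m) : IsWeightedHomogeneous w' (aeval g φ) m := by
  classical
  rw [φ.as_sum, map_sum]
  refine IsWeightedHomogeneous.sum φ.support _ m fun d hd => ?_
  rw [aeval_monomial, Algebra.algebraMap_eq_smul_one, smul_mul_assoc, one_mul]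
  have hdm : Finsupp.weight w d = m := hφ (mem_support_iff.mp hd)
  rw [← hdm, Finsupp.weight_apply, Finsupp.sum, Finsupp.prod, smul_eq_C_mul]
  refine IsWeightedHomogeneous.C_mul ?_ _
  exact IsWeightedHomogeneous.prod d.support (fun i => g i ^ d i) (fun i => d i • w i)
    fun i _ => (hg i).pow (d i)

/-- **The generic permanent has weight zero** for the weighting `X_(a,b) ↦ b - a ∈ ℤ/n`
(each term `Π_l X_(σ l, l)` has weight `Σ_l l - Σ_l σ l = 0`). [folklore] -/
theorem bpw_perPoly_isWeightedHomogeneous {R : Type*} [CommRing R] (n : ℕ) :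
    IsWeightedHomogeneous (fun ab : Fin n × Fin n => ((ab.2 : ℕ) : ZMod n) - ((ab.1 : ℕ) : ZMod n))
      (perPoly (Fin n) R) 0 := by
  have hper : perPoly (Fin n) R = ∑ σ : Equiv.Perm (Fin n), ∏ l, (X (σ l, l) : MvPolynomial _ R) := by
    simp only [perPoly, Matrix.permanent, Matrix.mvPolynomialX_apply]
  rw [hper]
  refine IsWeightedHomogeneous.sum Finset.univ _ 0 fun σ _ => ?_
  have h := IsWeightedHomogeneous.prod (w := fun ab : Fin n × Fin n =>
      ((ab.2 : ℕ) : ZMod n) - ((ab.1 : ℕ) : ZMod n)) Finset.univ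
    (fun l : Fin n => (X (σ l, l) : MvPolynomial (Fin n × Fin n) R))
    (fun l => ((l : ℕ) : ZMod n) - (((σ l : Fin n) : ℕ) : ZMod n))
    (fun l _ => isWeightedHomogeneous_X R _ (σ l, l))
  have hsum : ∑ l : Fin n, (((l : ℕ) : ZMod n) - (((σ l : Fin n) : ℕ) : ZMod n)) = 0 := by
    rw [Finset.sum_sub_distrib, Equiv.sum_comp σ (fun l : Fin n => ((l : ℕ) : ZMod n)), sub_self]
  rwa [hsum] at h

/-- **Class weights of the band-pencil products.**  Let `M : Fin n × Fin n → Fin 4 → R` be a cyclic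
band pencil: `M (a, b) t ≠ 0` only if `b ≡ a + t (mod n)`.  Then the product
`X t * aeval (fun ab => Σ_s M ab s • X s) (∂_(i,j) per_n)` — the general member of the family in
hypothesis `H` of `fourRowPencilRank_of_pencilCertificate` — is weighted-homogeneous for
`y_s ↦ s ∈ ℤ/n`, of weight `t + (i - j)`.  So products in different classes `i - j + t (mod n)` have
disjoint monomial supports and `rank = Σ_q rank_q`. [this crux, line four-row-count card; folklore] -/
theorem bpw_bandProduct_isWeightedHomogeneous {R : Type*} [CommRing R] (n : ℕ)
    (M : Fin n × Fin n → Fin 4 → R)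
    (hM : ∀ (a b : Fin n) (t : Fin 4), M (a, b) t ≠ 0 →
      ((b : ℕ) : ZMod n) = ((a : ℕ) : ZMod n) + ((t : ℕ) : ZMod n))
    (t : Fin 4) (i j : Fin n) :
    IsWeightedHomogeneous (fun s : Fin 4 => ((s : ℕ) : ZMod n))
      ((X t : MvPolynomial (Fin 4) R) *
        aeval (fun ab : Fin n × Fin n => ∑ s : Fin 4, M ab s • (X s : MvPolynomial (Fin 4) R))
          (pderiv (i, j) (perPoly (Fin n) R)))
      (((t : ℕ) : ZMod n) + (((i : ℕ) : ZMod n) - ((j : ℕ) : ZMod n))) := by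
  refine (isWeightedHomogeneous_X R _ t).mul ?_
  -- the substituted values are weighted-homogeneous of the column-minus-row weight
  have hg : ∀ ab : Fin n × Fin n, IsWeightedHomogeneous (fun s : Fin 4 => ((s : ℕ) : ZMod n))
      (∑ s : Fin 4, M ab s • (X s : MvPolynomial (Fin 4) R))
      (((ab.2 : ℕ) : ZMod n) - ((ab.1 : ℕ) : ZMod n)) := by
    rintro ⟨a, b⟩
    refine IsWeightedHomogeneous.sum Finset.univ _ _ fun s _ => ?_
    by_cases hs : M (a, b) s = 0
    · rw [hs, zero_smul]
      exact isWeightedHomogeneous_zero R _ _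
    · rw [smul_eq_C_mul]
      have hw : ((b : ℕ) : ZMod n) - ((a : ℕ) : ZMod n) = ((s : ℕ) : ZMod n) := by
        rw [hM a b s hs, add_sub_cancel_left]
      rw [hw]
      exact (isWeightedHomogeneous_X R _ s).C_mul _
  have hφ := bpw_isWeightedHomogeneous_pderiv
    (fun ab : Fin n × Fin n => ((ab.2 : ℕ) : ZMod n) - ((ab.1 : ℕ) : ZMod n))
    (bpw_perPoly_isWeightedHomogeneous (R := R) n) (i, j)
  have hw : (0 : ZMod n) - (((j : ℕ) : ZMod n) - ((i : ℕ) : ZMod n)) =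
      ((i : ℕ) : ZMod n) - ((j : ℕ) : ZMod n) := by abel
  rw [hw] at hφ
  exact bpw_isWeightedHomogeneous_aeval _ _ _ hg hφ

end Summit.ValiantsHypothesis.ValiantsHypothesis.Theorems.ValuativeFlip
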